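import Literature.Probability.Divergences.DonskerVaradhan
import Literature.Probability.Divergences.KLDivConvexity
import HarnessLib

/-!
# Superadditivity of the Kullback–Leibler divergence with respect to a product reference (Polyanskiy–Wu Thm 2.16(c))

Topic `Literature/Probability/Divergences`.  PROVED (no named facts, no definitions), for Mathlib's
`InformationTheory.klDiv` and the marginals `Measure.fst` / `Measure.snd` of a probability law on a binary product:

* `toReal_klDiv_fst_add_snd_le` — for probability measures `P` on `X × Y`, `Q₁` on `X`, `Q₂` on `Y` with
  `KL(P ‖ Q₁ ⊗ Q₂) < ∞`: both marginal divergences are finite and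
  `KL(P_X ‖ Q₁) + KL(P_Y ‖ Q₂) ≤ KL(P ‖ Q₁ ⊗ Q₂)` [cite: PolyanskiyWu2024, Thm 2.16(c) eq. (2.27)]
  (there for `n` factors on standard Borel spaces, via the chain rule; TODO(general form): `n`-fold products).

The proof here is by DUALITY and needs no standard-Borel hypothesis and no disintegration: for bounded measurable
`g₁, g₂` the test function `g₁ ⊕ g₂` in the Donsker–Varadhan inequality (`integral_le_toReal_klDiv_add_log`) factorises
over the product reference (`integral_prod_mul`), giving
`[E_{P_X} g₁ − log E_{Q₁} e^{g₁}] + [E_{P_Y} g₂ − log E_{Q₂} e^{g₂}] ≤ KL(P ‖ Q₁ ⊗ Q₂)`; the HARD half of Donsker–Varadhan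
for bounded test functions (`klDiv_le_of_forall_integral_le`) turns the two suprema into the marginal divergences one at a time.

Why here: the localisation step of the relative entropy method (Csiszár's chain rule / "an extensive entropy budget against a
product reference is a sum of block budgets") used by the Yang–Mills entropy-budget line (`Summits/…/EntropyBudgetEquipartition*`)
and by hydrodynamic-limit arguments; the finite-law tensorization identities are in `Entropy/DivergenceTensorization.lean`.
-/

noncomputable section

namespace Literature.Probability.Divergences

open _root_.MeasureTheory Filter InformationTheory

variable {X Y : Type*} [MeasurableSpace X] [MeasurableSpace Y]

/-- The Donsker–Varadhan functional of a sum test function `g₁ ⊕ g₂` splits over the marginals and a product reference: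
for bounded measurable `g₁, g₂` and probability measures `P` on `X × Y`, `Q₁`, `Q₂` with `KL(P ‖ Q₁ ⊗ Q₂) < ∞`,
`[∫ g₁ dP_X − log ∫ e^{g₁} dQ₁] + [∫ g₂ dP_Y − log ∫ e^{g₂} dQ₂] ≤ KL(P ‖ Q₁ ⊗ Q₂)`. [folklore] -/
private theorem dv_sum_le {P : Measure (X × Y)} [IsProbabilityMeasure P] {Q₁ : Measure X} [IsProbabilityMeasure Q₁]
    {Q₂ : Measure Y} [IsProbabilityMeasure Q₂] (hfin : klDiv P (Q₁.prod Q₂) ≠ ⊤)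
    {g₁ : X → ℝ} {g₂ : Y → ℝ} {C₁ C₂ : ℝ} (hg₁ : Measurable g₁) (hC₁ : ∀ x, |g₁ x| ≤ C₁)
    (hg₂ : Measurable g₂) (hC₂ : ∀ y, |g₂ y| ≤ C₂) :
    (∫ x, g₁ x ∂P.fst) - Real.log (∫ x, Real.exp (g₁ x) ∂Q₁) +
      ((∫ y, g₂ y ∂P.snd) - Real.log (∫ y, Real.exp (g₂ y) ∂Q₂)) ≤ (klDiv P (Q₁.prod Q₂)).toReal := by
  -- the bounded measurable test function `ψ(x, y) = g₁ x + g₂ y`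
  have hψ : Measurable fun p : X × Y => g₁ p.1 + g₂ p.2 := (hg₁.comp measurable_fst).add (hg₂.comp measurable_snd)
  have hψC : ∀ p : X × Y, |g₁ p.1 + g₂ p.2| ≤ C₁ + C₂ := fun p =>
    (abs_add_le _ _).trans (add_le_add (hC₁ p.1) (hC₂ p.2))
  have dv := integral_le_toReal_klDiv_add_log (μ := P) (ν := Q₁.prod Q₂) hfin hψ hψC
  -- `∫ ψ dP = ∫ g₁ dP_X + ∫ g₂ dP_Y`
  have hi₁ : Integrable (fun p : X × Y => g₁ p.1) P :=
    Integrable.of_bound (hg₁.comp measurable_fst).aestronglyMeasurable C₁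
      (ae_of_all _ fun p => by rw [Real.norm_eq_abs]; exact hC₁ p.1)
  have hi₂ : Integrable (fun p : X × Y => g₂ p.2) P :=
    Integrable.of_bound (hg₂.comp measurable_snd).aestronglyMeasurable C₂
      (ae_of_all _ fun p => by rw [Real.norm_eq_abs]; exact hC₂ p.2)
  have hsum : (∫ p, g₁ p.1 + g₂ p.2 ∂P) = (∫ x, g₁ x ∂P.fst) + ∫ y, g₂ y ∂P.snd := by
    rw [integral_add hi₁ hi₂, Measure.fst, Measure.snd,
      integral_map measurable_fst.aemeasurable hg₁.aestronglyMeasurable,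
      integral_map measurable_snd.aemeasurable hg₂.aestronglyMeasurable]
  -- `∫ e^ψ d(Q₁ ⊗ Q₂) = ∫ e^{g₁} dQ₁ · ∫ e^{g₂} dQ₂`
  have hprod : (∫ p, Real.exp (g₁ p.1 + g₂ p.2) ∂Q₁.prod Q₂) =
      (∫ x, Real.exp (g₁ x) ∂Q₁) * ∫ y, Real.exp (g₂ y) ∂Q₂ := by
    simp_rw [Real.exp_add]
    exact integral_prod_mul (fun x => Real.exp (g₁ x)) (fun y => Real.exp (g₂ y))
  have hpos₁ : 0 < ∫ x, Real.exp (g₁ x) ∂Q₁ :=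
    integral_exp_pos (Integrable.of_bound hg₁.exp.aestronglyMeasurable (Real.exp C₁)
      (ae_of_all _ fun x => by
        rw [Real.norm_eq_abs, abs_of_pos (Real.exp_pos _), Real.exp_le_exp]
        exact (le_abs_self _).trans (hC₁ x)))
  have hpos₂ : 0 < ∫ y, Real.exp (g₂ y) ∂Q₂ :=
    integral_exp_pos (Integrable.of_bound hg₂.exp.aestronglyMeasurable (Real.exp C₂)
      (ae_of_all _ fun y => by
        rw [Real.norm_eq_abs, abs_of_pos (Real.exp_pos _), Real.exp_le_exp]
        exact (le_abs_self _).trans (hC₂ y)))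
  rw [hsum, hprod, Real.log_mul hpos₁.ne' hpos₂.ne'] at dv
  linarith

/-- From a Donsker–Varadhan bound with budget `K` to the real inequality `KL.toReal ≤ K` (and finiteness). [folklore] -/
private theorem toReal_klDiv_le_of_forall {α : Type*} [MeasurableSpace α] {μ ν : Measure α}
    [IsProbabilityMeasure μ] [IsProbabilityMeasure ν] {K : ℝ}
    (h : ∀ (ψ : α → ℝ) (C : ℝ), Measurable ψ → (∀ x, |ψ x| ≤ C) →
      ∫ x, ψ x ∂μ ≤ K + Real.log (∫ x, Real.exp (ψ x) ∂ν)) :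
    klDiv μ ν ≠ ⊤ ∧ (klDiv μ ν).toReal ≤ K := by
  have hK : 0 ≤ K := by
    have := h (fun _ => 0) 0 measurable_const (fun _ => by simp)
    simp only [integral_const, smul_eq_mul, mul_zero, Real.exp_zero, probReal_univ, mul_one, Real.log_one,
      add_zero] at this
    exact this
  have hle := klDiv_le_of_forall_integral_le h
  refine ⟨ne_top_of_le_ne_top ENNReal.ofReal_ne_top hle, ?_⟩
  exact (ENNReal.toReal_mono ENNReal.ofReal_ne_top hle).trans (by rw [ENNReal.toReal_ofReal hK])

/-- **Superadditivity of relative entropy for a product reference** (binary case of Polyanskiy–Wu (2.27)): for probability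
measures `P` on `X × Y`, `Q₁` on `X`, `Q₂` on `Y` with `KL(P ‖ Q₁ ⊗ Q₂) < ∞`, the marginal divergences are finite and
`KL(P_X ‖ Q₁) + KL(P_Y ‖ Q₂) ≤ KL(P ‖ Q₁ ⊗ Q₂)`.  Proved by duality (no standard-Borel hypothesis).
[cite: PolyanskiyWu2024, Thm 2.16(c) eq. (2.27)] -/
theorem toReal_klDiv_fst_add_snd_le {P : Measure (X × Y)} [IsProbabilityMeasure P] {Q₁ : Measure X}
    [IsProbabilityMeasure Q₁] {Q₂ : Measure Y} [IsProbabilityMeasure Q₂] (hfin : klDiv P (Q₁.prod Q₂) ≠ ⊤) :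
    klDiv P.fst Q₁ ≠ ⊤ ∧ klDiv P.snd Q₂ ≠ ⊤ ∧
      (klDiv P.fst Q₁).toReal + (klDiv P.snd Q₂).toReal ≤ (klDiv P (Q₁.prod Q₂)).toReal := by
  set K : ℝ := (klDiv P (Q₁.prod Q₂)).toReal with hK
  -- first marginal: test functions `g₁ ⊕ 0`
  have h₁ : klDiv P.fst Q₁ ≠ ⊤ ∧ (klDiv P.fst Q₁).toReal ≤ K := by
    refine toReal_klDiv_le_of_forall fun ψ C hψ hC => ?_
    have := dv_sum_le hfin hψ hC (g₂ := fun _ => (0 : ℝ)) (C₂ := 0) measurable_const (fun _ => by simp)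
    simp only [integral_const, smul_eq_mul, mul_zero, Real.exp_zero, probReal_univ, mul_one, Real.log_one,
      sub_zero, add_zero] at this
    linarith
  set K₁ : ℝ := (klDiv P.fst Q₁).toReal with hK₁
  -- second marginal: for every `g₂`, the `g₁`-supremum is `KL(P_X ‖ Q₁)`, so the budget left is `K − K₁`
  have h₂ : klDiv P.snd Q₂ ≠ ⊤ ∧ (klDiv P.snd Q₂).toReal ≤ K - K₁ := by
    refine toReal_klDiv_le_of_forall fun g₂ C₂ hg₂ hC₂ => ?_
    -- `KL(P_X ‖ Q₁) ≤ K − D₂(g₂)` by the hard half of Donsker–Varadhan in the first factor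
    have inner : klDiv P.fst Q₁ ≠ ⊤ ∧ (klDiv P.fst Q₁).toReal ≤
        K - ((∫ y, g₂ y ∂P.snd) - Real.log (∫ y, Real.exp (g₂ y) ∂Q₂)) := by
      refine toReal_klDiv_le_of_forall fun g₁ C₁ hg₁ hC₁ => ?_
      have := dv_sum_le hfin hg₁ hC₁ hg₂ hC₂
      linarith
    linarith [inner.2]
  exact ⟨h₁.1, h₂.1, by linarith [h₂.2]⟩

/-- **Superadditivity, `ℝ≥0∞` form**: `KL(P_X ‖ Q₁) + KL(P_Y ‖ Q₂) ≤ KL(P ‖ Q₁ ⊗ Q₂)` for probability measures (trivial when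
the right side is infinite). [cite: PolyanskiyWu2024, Thm 2.16(c) eq. (2.27)] -/
theorem klDiv_fst_add_snd_le {P : Measure (X × Y)} [IsProbabilityMeasure P] {Q₁ : Measure X}
    [IsProbabilityMeasure Q₁] {Q₂ : Measure Y} [IsProbabilityMeasure Q₂] :
    klDiv P.fst Q₁ + klDiv P.snd Q₂ ≤ klDiv P (Q₁.prod Q₂) := by
  by_cases hfin : klDiv P (Q₁.prod Q₂) = ⊤
  · rw [hfin]; exact le_top
  obtain ⟨h₁, h₂, hle⟩ := toReal_klDiv_fst_add_snd_le hfin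
  rw [← ENNReal.ofReal_toReal h₁, ← ENNReal.ofReal_toReal h₂, ← ENNReal.ofReal_toReal hfin,
    ← ENNReal.ofReal_add ENNReal.toReal_nonneg ENNReal.toReal_nonneg]
  exact ENNReal.ofReal_le_ofReal hle

end Literature.Probability.Divergences

end
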